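import Literature.Analysis.FluidPDE.ForwardDSSMollifiedDrift
import Literature.Analysis.FluidPDE.DissipationAnomaly
import HarnessLib

/-!
# Bridge: `BradshawTsai2019.scaledMollifier` is `FluidPDE.mollifierScale` on `EuclideanSpace ℝ d`

Analysis/FluidPDE bridge file (theorems only). The tree has two renderings of the scaled
mollifier `η_δ(y) = δ⁻ⁿ η(y/δ)`: `FluidPDE.mollifierScale δ η` on `EuclideanSpace ℝ d` with
`n = card d` (`DissipationAnomaly`, the Duchon–Robert chain) and the general-`E` form
`BradshawTsai2019.scaledMollifier η δ` with `n = finrank ℝ E` (`ForwardDSSMollifiedDrift`, the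
DSS chain, stated over a general finite-dimensional inner product space). This file records that
they agree on `EuclideanSpace ℝ d` (`finrank_euclideanSpace`), so that the mollifier facts of
either chain (`IsMollifier.mollifierScale`, `integral_mollifierScale`;
`integral_scaledMollifier`, `scaledMollifier_mul_smul`, …) transfer. It is kept separate from
both files so that neither chain imports the other (refactor note for the librarian: one of the
two definitions should eventually be retired in favour of the general-`E` one).
-/

noncomputable section

namespace Literature.Analysis.FluidPDE

/-- **Bridge**: on `EuclideanSpace ℝ d`, `BradshawTsai2019.scaledMollifier η δ = mollifierScale δ η`
(same formula, `card d = finrank ℝ (EuclideanSpace ℝ d)`). [folklore] -/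
theorem BradshawTsai2019.scaledMollifier_eq_mollifierScale {d : Type*} [Fintype d]
    (η : EuclideanSpace ℝ d → ℝ) (δ : ℝ) :
    BradshawTsai2019.scaledMollifier η δ = mollifierScale δ η := by
  funext y
  rw [BradshawTsai2019.scaledMollifier_apply, mollifierScale_apply, finrank_euclideanSpace]

/-- Hence the Duchon–Robert mollifier class is preserved: for a mollifier `η` (`IsMollifier`) and
`δ > 0`, `BradshawTsai2019.scaledMollifier η δ` is again a mollifier. [folklore] -/
theorem BradshawTsai2019.isMollifier_scaledMollifier {d : Type*} [Fintype d]
    {η : EuclideanSpace ℝ d → ℝ} (hη : IsMollifier η) {δ : ℝ} (hδ : 0 < δ) :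
    IsMollifier (BradshawTsai2019.scaledMollifier η δ) := by
  rw [BradshawTsai2019.scaledMollifier_eq_mollifierScale]
  exact hη.mollifierScale hδ

end Literature.Analysis.FluidPDE

end
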